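import Mathlib.Analysis.Calculus.BumpFunction.FiniteDimension
import Mathlib.Analysis.SpecialFunctions.Pow.Deriv
import Literature.Probability.RandomPlanarGeometry.SLEOnePointNonSwallowing
import Literature.Probability.RandomPlanarGeometry.SLERealFlowGenerator
import HarnessLib

/-!
# No swallowing of real points for `κ ≤ 4`: the one-point Itô steps discharged, and Lawler's Prop. 6.8 (first assertion)

Topic `Probability/RandomPlanarGeometry`; theorems only (proof sibling of
`SLEOnePointNonSwallowing`). Two things are proved here.

**(A) The two Itô steps for `κ ≤ 4` are theorems.** The named facts
`Literature.Probability.RandomPlanarGeometry.sle_martingale_onePointPow_of_lt_four`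
(`(X_{t∧σ})^{1-4/κ}` is a martingale, `0 < κ < 4`, levels `0 < x₁ < x < x₂`) and
`Literature.Probability.RandomPlanarGeometry.sle_martingale_onePointLog` (`log X_{t∧σ}` is a
martingale, `κ = 4`) are discharged (`…_holds`) as the instances `F = u^{1-4/κ}`, `F = log u`,
`c = 0` of the tree's generator theorem `martingale_generator_sleRealFlowStop`
(`SLERealFlowGenerator`: for `F ∈ C²(ℝ)` with `(2/u)F' + (κ/2)F'' = c` on `[x₁, x₂]`,
`F(X_{t∧σ}) - c(t∧σ)` is a martingale, from the tree's Itô formula). The only work is a `C²`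
extension of `u^{1-4/κ}` / `log u` off the compact interval `[x₁, x₂] ⊆ (0, ∞)` (smooth cut-off,
`exists_contDiff_eventuallyEq_of_pos`, Mathlib's `ContDiffBump`) and the vanishing of the
generator: `(2/u) q u^{q-1} + (κ/2) q(q-1) u^{q-2} = 0` for `q = 1 - 4/κ`, and
`(2/u)(1/u) + 2·(-1/u²) = 0` for `κ = 4`.

**(B) Lawler (2005), Prop. 6.8, first assertion** ("if `κ ≤ 4`, then w.p.1 `T_x = ∞` for all
`x > 0`"; printed proof: "a restatement of Proposition 1.21 with `a = 2/κ`"; Prop. 1.21, first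
assertion: "if `a ≥ 1/2`, then w.p.1 `T_x = ∞`", proved by optional stopping of
`M_t = φ₀(X_{t∧σ})` and `x₁ → 0+`), now unconditionally:
**for `0 < κ ≤ 4` and `x > 0`, almost surely `T_x = ∞`**
(`Literature.Probability.RandomPlanarGeometry.ae_sle_swallowingTime_eq_top_of_le_four`).

Steps of (B) (`X` the frozen real flow from `x`, `σ` its exit time from `(x₁, x₂)`,
`0 < x₁ < x < x₂`):
1. pathwise: `x₁ ≤ X_{t∧σ} ≤ x₂`; at the lower hitting time `X = x₁`; if `T_x ≤ t` and the level
   `x₂` is not reached by time `t`, then `X_{t∧σ} = x₁` (the continuous flow, which vanishes at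
   `T_x`, crosses `x₁` first); every path is bounded on `[0, t]`, so some integer level is not
   reached by time `t`;
2. optional stopping as a Markov inequality (no a.s. finiteness of `σ` is needed): from
   `E[X^q_{t∧σ}] = x^q`, `q = 1 - 4/κ < 0`, and `X^q_{t∧σ} ≤ x₁^q` with equality exactly on
   `{X_{t∧σ} = x₁}`: `P{X_{t∧σ} = x₁} ≤ (x/x₁)^q = (x₁/x)^{4/κ-1}`; for `κ = 4`, from
   `E[log X_{t∧σ}] = log x` and `log X_{t∧σ} ≤ log x₂`:
   `P{X_{t∧σ} = x₁} ≤ log(x₂/x)/log(x₂/x₁)`;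
3. both bounds tend to `0` as `x₁ → 0+`, so `P{T_x ≤ t, level n not reached by time t} = 0` for
   every `n`, whence `P{T_x ≤ t} = 0` for every `t` and `T_x = ∞` a.s.

Consequences: the direction "`⇒`" of `Literature.Analysis.FunctionSpaces.sle_swallows_real_iff`
(a.s. swallowing forces `κ > 4`) is a theorem, hence — with `SLEOnePointSwallowingProofs` for
"`⇐`" — the named fact `sle_swallows_real_iff` follows from the two one-point Itô steps for
`κ > 4` alone (`sle_swallows_real_iff_of_onePointMartingales`); and the hypothesis `h₃` of
`eq_six_of_forall_measureReal_hitsBefore_of_martingale_halfPlane`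
(`CritPercSLELocalityMartingaleProofs`) holds in the exact form used there
(`not_ae_sle_swallowingTime_lt_top_of_le_four`).

## Mathlib

We USE `ContDiffBump` (smooth cut-off), `Real.contDiffAt_rpow_const_of_ne`, `Real.contDiffAt_log`,
`Real.deriv_rpow_const`, `Real.deriv_log`, `deriv_inv`, `Filter.EventuallyEq.deriv_eq` /
`.iteratedDeriv_eq`, `MeasureTheory.mul_meas_ge_le_integral_of_nonneg` (Markov's inequality),
`MeasureTheory.Martingale.setIntegral_eq` (through `integral_eq_of_martingale`),
`MeasureTheory.stoppedProcess`, `measure_iUnion_null`, `ge_of_tendsto`, `Filter.Tendsto.div_atTop`,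
`Real.tendsto_log_nhdsGT_zero`, `Real.continuous_rpow_const`, `IsCompact.exists_isMaxOn`. Mathlib has
no Bessel processes / Loewner flow (searched `Bessel`, `Loewner`, `swallow`).

## References

* G. F. Lawler, *Conformally Invariant Processes in the Plane* (2005), §1.10, Prop. 1.21 and the
  first paragraph of its proof; §6.2, eq. (6.3), Prop. 6.8.
* S. Rohde, O. Schramm, *Basic properties of SLE*, Ann. of Math. 161 (2005), §6, proof of
  Lemma 6.2 ("Itô's formula shows that `F(Y_x(t ∧ T))` is a local martingale") and Lemma 6.5.
-/

noncomputable section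

open Set Filter Topology MeasureTheory Complex
open scoped NNReal ENNReal

namespace Literature.Probability.RandomPlanarGeometry

/-! ### (A) The Itô steps for `κ ≤ 4` from the generator theorem -/

section ItoSteps

open Loewner

/-- **Smooth cut-off extension off a compact interval of the positive half-line.** If `g` is
`Cⁿ` at every point of `(0, ∞)` and `0 < x₁ ≤ x₂`, there is a globally `Cⁿ` function `F` that
agrees with `g` on a neighbourhood of every point of `[x₁, x₂]`: `F = χ · g` for a smooth bump
`χ` equal to `1` near `[x₁, x₂]` and supported in `(x₁/2, ∞)` (Mathlib's `ContDiffBump`), so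
that `F` vanishes identically near `(-∞, 0]`. [folklore] -/
theorem exists_contDiff_eventuallyEq_of_pos {g : ℝ → ℝ} {n : ℕ∞} {x₁ x₂ : ℝ}
    (hx₁ : 0 < x₁) (h₁₂ : x₁ ≤ x₂) (hg : ∀ u : ℝ, 0 < u → ContDiffAt ℝ n g u) :
    ∃ F : ℝ → ℝ, ContDiff ℝ n F ∧ ∀ u ∈ Icc x₁ x₂, F =ᶠ[𝓝 u] g := by
  set c : ℝ := (x₁ + x₂) / 2 with hc
  let χ : ContDiffBump c :=
    ⟨(x₂ - x₁) / 2 + x₁ / 4, (x₂ - x₁) / 2 + x₁ / 2, by linarith, by linarith⟩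
  have hrIn : χ.rIn = (x₂ - x₁) / 2 + x₁ / 4 := rfl
  have hrOut : χ.rOut = (x₂ - x₁) / 2 + x₁ / 2 := rfl
  refine ⟨fun u ↦ χ u * g u, ?_, ?_⟩
  · rw [contDiff_iff_contDiffAt]
    intro u
    by_cases hu : 0 < u
    · exact χ.contDiffAt.mul (hg u hu)
    · -- near a point `u ≤ 0` the cut-off vanishes identically
      have hzero : (fun v ↦ χ v * g v) =ᶠ[𝓝 u] fun _ ↦ 0 := by
        filter_upwards [Iio_mem_nhds (show u < x₁ / 2 by linarith [not_lt.1 hu])] with v hv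
        have hv' : v < x₁ / 2 := hv
        have hdist : χ.rOut ≤ dist v c := by
          rw [hrOut, Real.dist_eq, abs_of_nonpos (by rw [hc]; linarith), hc]
          linarith
        rw [χ.zero_of_le_dist hdist, zero_mul]
      exact contDiffAt_const.congr_of_eventuallyEq hzero
  · intro u hu
    have hball : u ∈ Metric.ball c χ.rIn := by
      rw [Metric.mem_ball, Real.dist_eq, abs_lt, hrIn, hc]
      constructor
      · linarith [hu.1]
      · linarith [hu.2]
    filter_upwards [χ.eventuallyEq_one_of_mem_ball hball] with v hv
    rw [hv, Pi.one_apply, one_mul]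

/-- **Lawler's power observable is the generator instance `F = u^{1-4/κ}`, `c = 0`**: the
vanishing of the generator, `(2/u) · q u^{q-1} + (κ/2) · q (q-1) u^{q-2} = 0` for `q = 1 - 4/κ`
and `u > 0` (`(κ/2)(q - 1) = -2`). [cite: Lawler2005, §1.10 Prop. 1.21] -/
theorem generator_rpow_eq_zero {κ : ℝ} (hκ : κ ≠ 0) {u : ℝ} (hu : 0 < u) :
    2 / u * deriv (fun v : ℝ ↦ v ^ (1 - 4 / κ)) u +
      κ / 2 * iteratedDeriv 2 (fun v : ℝ ↦ v ^ (1 - 4 / κ)) u = 0 := by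
  set q : ℝ := 1 - 4 / κ with hq
  have h2 : iteratedDeriv 2 (fun v : ℝ ↦ v ^ q) u = q * ((q - 1) * u ^ (q - 1 - 1)) := by
    rw [iteratedDeriv_succ, iteratedDeriv_one, Real.deriv_rpow_const', deriv_const_mul _
      (Real.hasStrictDerivAt_rpow_const_of_ne hu.ne' _).hasDerivAt.differentiableAt,
      Real.deriv_rpow_const]
  rw [Real.deriv_rpow_const, h2, Real.rpow_sub_one hu.ne' (q - 1)]
  have hk : κ / 2 * (q - 1) = -2 := by
    rw [hq, show κ / 2 * (1 - 4 / κ - 1) = -2 * (κ / κ) by ring, div_self hκ, mul_one]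
  calc 2 / u * (q * u ^ (q - 1)) + κ / 2 * (q * ((q - 1) * (u ^ (q - 1) / u)))
      = q * u ^ (q - 1) / u * (2 + κ / 2 * (q - 1)) := by ring
    _ = 0 := by rw [hk]; ring

/-- **Lawler's logarithmic observable is the generator instance `F = log u`, `c = 0`, `κ = 4`**:
`(2/u)(1/u) + 2 · (-1/u²) = 0` (all `u`; at `u = 0` by Mathlib's junk values `0⁻¹ = 0`,
`deriv` of a non-differentiable function `= 0`). [cite: Lawler2005, §1.10 Prop. 1.21] -/
theorem generator_log_eq_zero (u : ℝ) :
    2 / u * deriv Real.log u + 4 / 2 * iteratedDeriv 2 Real.log u = 0 := by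
  rw [iteratedDeriv_succ, iteratedDeriv_one, Real.deriv_log',
    show deriv (Inv.inv : ℝ → ℝ) u = -(u ^ 2)⁻¹ from deriv_inv]
  ring

/-- **The Itô step for `κ < 4` is a theorem**: discharge of the named fact
`sle_martingale_onePointPow_of_lt_four` (Lawler (2005), proof of Prop. 1.21: "Itô's formula shows
that `M_t := φ₀(X_{t∧σ})` is a bounded martingale", `a = 2/κ > 1/2`) as the instance
`F = u^{1-4/κ}` (extended `C²` off `[x₁, x₂]`), `c = 0` of `martingale_generator_sleRealFlowStop`
(`SLERealFlowGenerator`, from the tree's Itô formula): on `[x₁, x₂] ∋ X_{t∧σ}` the extension agrees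
with `u^{1-4/κ}`, so the generator martingale *is* `sleOnePointPow κ x x₁ x₂` (Lawler's exit time
`sleExitTime` being the exit time of `ContinuousHitting`, `sleExitTime_eq_exitTime`).
[cite: Lawler2005, §1.10 Prop. 1.21] -/
theorem sle_martingale_onePointPow_of_lt_four_holds : sle_martingale_onePointPow_of_lt_four := by
  intro κ hκ0 hκ x x₁ x₂ hx₁ hx₁x hx₂
  have hx : 0 < x := hx₁.trans hx₁x
  have hκ0' : (κ : ℝ) ≠ 0 := by exact_mod_cast hκ0.ne'
  obtain ⟨F, hF, hFg⟩ := exists_contDiff_eventuallyEq_of_pos (n := 2) (g := fun u : ℝ ↦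
    u ^ (1 - 4 / (κ : ℝ))) hx₁ (hx₁x.trans hx₂).le
    fun u hu ↦ Real.contDiffAt_rpow_const_of_ne hu.ne'
  have hgen : ∀ u ∈ Icc x₁ x₂, 2 / u * deriv F u + (κ : ℝ) / 2 * iteratedDeriv 2 F u = 0 := by
    intro u hu
    rw [(hFg u hu).deriv_eq, (hFg u hu).iteratedDeriv_eq 2]
    exact generator_rpow_eq_zero hκ0' (hx₁.trans_le hu.1)
  have hM := martingale_generator_sleRealFlowStop (κ := κ) hx₁ hx₁x hx₂ hF hgen
  have hproc : sleOnePointPow κ x x₁ x₂ = fun t ω ↦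
      F (stoppedProcess (sleRealFlowStop κ x) (Process.exitTime (sleRealFlowStop κ x) x₁ x₂) t ω) -
        0 * ((min (t : WithTop ℝ≥0) (Process.exitTime (sleRealFlowStop κ x) x₁ x₂ ω)).untopA : ℝ) := by
    funext t ω
    rw [zero_mul, sub_zero, sleOnePointPow, sleExitTime_eq_exitTime]
    exact ((hFg _ (stoppedProcess_sleRealFlowStop_mem_Icc' hx hx₁x hx₂ t ω)).eq_of_nhds).symm
  rw [hproc]
  exact hM

/-- **The Itô step for `κ = 4` is a theorem**: discharge of the named fact
`sle_martingale_onePointLog` (Lawler (2005), proof of Prop. 1.21, case `a = 1/2`: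
`φ₀ = (log x - log x₁)/(log x₂ - log x₁)`, "`M_t := φ₀(X_{t∧σ})` is a bounded martingale") as the
instance `F = log u` (extended `C²` off `[x₁, x₂]`), `c = 0`, `κ = 4` of
`martingale_generator_sleRealFlowStop`. [cite: Lawler2005, §1.10 Prop. 1.21] -/
theorem sle_martingale_onePointLog_holds : sle_martingale_onePointLog := by
  intro x x₁ x₂ hx₁ hx₁x hx₂
  have hx : 0 < x := hx₁.trans hx₁x
  obtain ⟨F, hF, hFg⟩ := exists_contDiff_eventuallyEq_of_pos (n := 2) (g := Real.log) hx₁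
    (hx₁x.trans hx₂).le fun u hu ↦ Real.contDiffAt_log.2 hu.ne'
  have hgen : ∀ u ∈ Icc x₁ x₂,
      2 / u * deriv F u + ((4 : ℝ≥0) : ℝ) / 2 * iteratedDeriv 2 F u = 0 := by
    intro u hu
    rw [(hFg u hu).deriv_eq, (hFg u hu).iteratedDeriv_eq 2, NNReal.coe_ofNat]
    exact generator_log_eq_zero u
  have hM := martingale_generator_sleRealFlowStop (κ := 4) hx₁ hx₁x hx₂ hF hgen
  have hproc : sleOnePointLog x x₁ x₂ = fun t ω ↦
      F (stoppedProcess (sleRealFlowStop 4 x) (Process.exitTime (sleRealFlowStop 4 x) x₁ x₂) t ω) -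
        0 * ((min (t : WithTop ℝ≥0) (Process.exitTime (sleRealFlowStop 4 x) x₁ x₂ ω)).untopA : ℝ) := by
    funext t ω
    rw [zero_mul, sub_zero, sleOnePointLog, sleExitTime_eq_exitTime]
    exact ((hFg _ (stoppedProcess_sleRealFlowStop_mem_Icc' hx hx₁x hx₂ t ω)).eq_of_nhds).symm
  rw [hproc]
  exact hM

end ItoSteps

namespace Loewner

variable {W : ℝ≥0 → ℝ} {x : ℝ}

/-! ### Step 1: the frozen real flow between two levels, along one path -/

/-- Before the lower hitting time the frozen flow is above the level. [folklore] -/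
theorem lt_realFlowStop_of_lt_lowerTime {x₁ : ℝ} {t : ℝ≥0}
    (ht : (t : WithTop ℝ≥0) < lowerTime W x x₁) : x₁ < realFlowStop W x t := by
  have := notMem_of_lt_firstHit ht
  simpa [not_le] using this

/-- The lower hitting time of a level below the starting value is positive. [folklore] -/
theorem lowerTime_pos (hW : Continuous W) (hx : W 0 < x) {x₁ : ℝ} (hx₁ : x₁ < x - W 0) :
    0 < lowerTime W x x₁ := by
  have hopen : IsOpen {s : ℝ≥0 | x₁ < realFlowStop W x s} :=
    isOpen_lt continuous_const (continuous_realFlowStop hW hx)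
  have h0 : (0 : ℝ≥0) ∈ {s : ℝ≥0 | x₁ < realFlowStop W x s} := by
    rw [mem_setOf_eq, realFlowStop_zero hW hx]; exact hx₁
  obtain ⟨ε, hε, hball⟩ := Metric.isOpen_iff.1 hopen 0 h0
  set η : ℝ≥0 := (ε / 2).toNNReal with hη
  have hηpos : 0 < η := Real.toNNReal_pos.2 (half_pos hε)
  have hηle : (η : WithTop ℝ≥0) ≤ lowerTime W x x₁ := by
    rw [lowerTime, firstHit]
    refine le_sInf ?_
    rintro _ ⟨t, ht, rfl⟩
    rw [WithTop.coe_le_coe]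
    by_contra hlt
    rw [not_le, hη, Real.lt_toNNReal_iff_coe_lt] at hlt
    have htball : t ∈ Metric.ball (0 : ℝ≥0) ε := by
      rw [Metric.mem_ball, NNReal.dist_eq, NNReal.coe_zero, sub_zero, abs_of_nonneg t.coe_nonneg]
      linarith
    have h1 : x₁ < realFlowStop W x t := hball htball
    have h2 : realFlowStop W x t ≤ x₁ := by simpa using ht
    linarith
  exact lt_of_lt_of_le (by exact_mod_cast hηpos) hηle

/-- **At the lower hitting time the frozen flow equals the level** (`W` continuous, `x > W₀`, level
below the start): the level is attained (closed target, continuous path) and not undershot (above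
the level just before). [folklore] -/
theorem realFlowStop_lowerTime_eq (hW : Continuous W) (hx : W 0 < x) {x₁ : ℝ} (hx₁ : x₁ < x - W 0)
    {b : ℝ≥0} (hb : lowerTime W x x₁ = b) : realFlowStop W x b = x₁ := by
  have hclosed : IsClosed {z : ℂ | z.re ≤ x₁} := isClosed_le continuous_re continuous_const
  obtain ⟨t₀, ht₀, hmem⟩ := exists_firstHit_eq_coe (S := {z : ℂ | z.re ≤ x₁})
    (continuous_realFlowStop_ofReal hW hx) hclosed (by rw [← lowerTime, hb]; exact WithTop.coe_ne_top)
  rw [← lowerTime, hb, WithTop.coe_eq_coe] at ht₀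
  subst ht₀
  have hle : realFlowStop W x b ≤ x₁ := by simpa using hmem
  have hb0 : 0 < b := by
    have := lowerTime_pos hW hx hx₁
    rw [hb] at this
    exact_mod_cast this
  have hge : x₁ ≤ realFlowStop W x b := by
    have hcw : ContinuousWithinAt (realFlowStop W x) (Iio b) b :=
      (continuous_realFlowStop hW hx).continuousWithinAt
    have hcl : b ∈ closure (Iio b) := by
      rw [closure_Iio' (show (Iio b : Set ℝ≥0).Nonempty from ⟨0, hb0⟩)]; exact (le_rfl : b ≤ b)
    have hmem' := hcw.mem_closure_image hcl
    have hsub : realFlowStop W x '' Iio b ⊆ Ioi x₁ := by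
      rintro _ ⟨s, hs, rfl⟩
      exact lt_realFlowStop_of_lt_lowerTime (by rw [hb]; exact_mod_cast hs)
    have := closure_mono hsub hmem'
    rw [closure_Ioi] at this
    exact this
  exact le_antisymm hle hge

/-- A nonnegative level is hit no later than the swallowing time (`x > W₀`): `lowerTime x₁ ≤ T_x`
for `x₁ ≥ 0`, since the frozen flow vanishes at `T_x`. [folklore] -/
theorem lowerTime_le_swallowingTime (hW : Continuous W) (hx : W 0 < x) {x₁ : ℝ} (hx₁ : 0 ≤ x₁) :
    lowerTime W x x₁ ≤ swallowingTime W x := by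
  rw [← lowerTime_zero_eq hW hx]
  exact firstHit_mono _ fun z (hz : z.re ≤ 0) ↦ show z.re ≤ x₁ from hz.trans hx₁

/-- **Swallowed paths exit at the lower level.** If `x` is swallowed by time `t` (`T_x ≤ t`) while
the level `x₂` is not reached by time `t`, then the frozen flow, stopped at the exit time of
`(x₁, x₂)` (`0 ≤ x₁ < x - W₀ < x₂`), sits at `x₁` at time `t`: the continuous flow vanishes at
`T_x`, so it reaches `x₁` at `lowerTime x₁ ≤ T_x ≤ t < levelTime x₂`. [cite: Lawler2005, §1.10 Prop. 1.21] -/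
theorem realFlowStop_untopA_eq_of_swallowingTime_le (hW : Continuous W) (hx : W 0 < x) {x₁ x₂ : ℝ}
    (hx₁0 : 0 ≤ x₁) (hx₁ : x₁ < x - W 0) {t : ℝ≥0} (hT : swallowingTime W x ≤ t)
    (hlev : (t : WithTop ℝ≥0) < levelTime W x x₂) :
    realFlowStop W x (min (t : WithTop ℝ≥0) (exitTime W x x₁ x₂)).untopA = x₁ := by
  have hlow : lowerTime W x x₁ ≤ t := (lowerTime_le_swallowingTime hW hx hx₁0).trans hT
  obtain ⟨b, hb⟩ := WithTop.ne_top_iff_exists.1 (ne_top_of_le_ne_top WithTop.coe_ne_top hlow)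
  have hbl : lowerTime W x x₁ < levelTime W x x₂ := hlow.trans_lt hlev
  have hσ : exitTime W x x₁ x₂ = b := by rw [exitTime, min_eq_left hbl.le, hb]
  have hbt : (b : WithTop ℝ≥0) ≤ t := by rw [hb]; exact hlow
  rw [hσ, min_eq_right hbt, WithTop.untopA_eq_untop WithTop.coe_ne_top, WithTop.untop_coe]
  exact realFlowStop_lowerTime_eq hW hx hx₁ hb.symm

/-- **Every path misses some integer level up to time `t`**: the frozen flow is continuous, hence
bounded on `[0, t]`, and a level above that bound (and above the start) is not reached by time `t`.
[folklore] -/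
theorem exists_nat_lt_levelTime (hW : Continuous W) (hx : W 0 < x) (t : ℝ≥0) :
    ∃ n : ℕ, x - W 0 < n ∧ (t : WithTop ℝ≥0) < levelTime W x n := by
  obtain ⟨s₀, -, hmax⟩ := (isCompact_Icc (a := (0 : ℝ≥0)) (b := t)).exists_isMaxOn
    (nonempty_Icc.2 zero_le) (continuous_realFlowStop hW hx).continuousOn
  obtain ⟨n, hn⟩ := exists_nat_gt (max (realFlowStop W x s₀) (x - W 0))
  refine ⟨n, (le_max_right _ _).trans_lt hn, ?_⟩
  by_contra hle
  rw [not_lt] at hle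
  obtain ⟨b, hb⟩ := WithTop.ne_top_iff_exists.1 (ne_top_of_le_ne_top WithTop.coe_ne_top hle)
  have hbt : b ≤ t := by rw [← hb] at hle; exact_mod_cast hle
  have hval : realFlowStop W x b = n :=
    realFlowStop_levelTime_eq hW hx ((le_max_right _ _).trans_lt hn) hb.symm
  have hle' : realFlowStop W x b ≤ realFlowStop W x s₀ := hmax ⟨zero_le, hbt⟩
  have : (n : ℝ) < n := by
    calc (n : ℝ) = realFlowStop W x b := hval.symm
      _ ≤ realFlowStop W x s₀ := hle'
      _ ≤ max (realFlowStop W x s₀) (x - W 0) := le_max_left _ _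
      _ < n := hn
  exact lt_irrefl _ this

end Loewner

/-! ### The SLE_κ one-point observables between positive levels -/

section SLE

open Loewner

variable {κ : ℝ≥0} {x x₁ x₂ : ℝ}

/-- The stopped frozen flow at time `0` is `x` (SLE: `W₀ = 0`), for any levels. [folklore] -/
theorem stoppedProcess_sleRealFlowStop_zero' (hx : 0 < x) (x₁ x₂ : ℝ) (ω : ℝ≥0 → ℝ) :
    stoppedProcess (sleRealFlowStop κ x) (sleExitTime κ x x₁ x₂) 0 ω = x := by
  rw [stoppedProcess, min_eq_left (coe_zero_le_withTop _), WithTop.untopA_eq_untop WithTop.coe_ne_top,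
    WithTop.untop_coe, sleRealFlowStop, realFlowStop_zero (continuous_sleDriving κ ω)
      (by rwa [sleDriving_zero]), sleDriving_zero, sub_zero]

/-- **`x₁ ≤ X_{t∧σ} ≤ x₂`** for Lawler's exit time `σ = sleExitTime κ x x₁ x₂` of `(x₁, x₂)`,
`x₁ < x < x₂`, every sample path (the tree's `stoppedProcess_sleRealFlowStop_mem_Icc'` of
`SLERealFlowGenerator`, through `sleExitTime_eq_exitTime`). [cite: Lawler2005, §1.10 Prop. 1.21] -/
theorem stoppedProcess_sleRealFlowStop_sleExitTime_mem_Icc (hx : 0 < x) (hx₁ : x₁ < x)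
    (hx₂ : x < x₂) (t : ℝ≥0) (ω : ℝ≥0 → ℝ) :
    stoppedProcess (sleRealFlowStop κ x) (sleExitTime κ x x₁ x₂) t ω ∈ Icc x₁ x₂ := by
  rw [sleExitTime_eq_exitTime]
  exact stoppedProcess_sleRealFlowStop_mem_Icc' hx hx₁ hx₂ t ω

/-- **Swallowed paths exit at the lower level** (SLE form): on `{T_x ≤ t} ∩ {t < levelTime x₂}` the
stopped flow equals `x₁` at time `t` (`0 ≤ x₁ < x`). [cite: Lawler2005, §1.10 Prop. 1.21] -/
theorem stoppedProcess_sleRealFlowStop_eq_of_swallowingTime_le (hx : 0 < x) (hx₁0 : 0 ≤ x₁)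
    (hx₁ : x₁ < x) {t : ℝ≥0} {ω : ℝ≥0 → ℝ} (hT : swallowingTime (sleDriving κ ω) x ≤ t)
    (hlev : (t : WithTop ℝ≥0) < levelTime (sleDriving κ ω) x x₂) :
    stoppedProcess (sleRealFlowStop κ x) (sleExitTime κ x x₁ x₂) t ω = x₁ := by
  rw [stoppedProcess, sleRealFlowStop, sleExitTime]
  exact realFlowStop_untopA_eq_of_swallowingTime_le (continuous_sleDriving κ ω)
    (by rwa [sleDriving_zero]) hx₁0 (by rw [sleDriving_zero, sub_zero]; exact hx₁) hT hlev

/-! ### Step 2: optional stopping as a Markov inequality -/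

/-- **`P{X_{t∧σ} = x₁} ≤ (x₁/x)^{4/κ-1}` for `κ < 4`** (Lawler (2005), proof of Prop. 1.21:
"`P{X_σ = x₂} = φ₀(x; x₁, x₂)`", here one-sided and at finite time, which needs no finiteness of
`σ`): with `q = 1 - 4/κ < 0`, `E[X^q_{t∧σ}] = x^q` (power martingale) and `X^q_{t∧σ} ≤ x₁^q` with
equality on `{X_{t∧σ} = x₁}`, Markov's inequality gives `x₁^q P{X_{t∧σ} = x₁} ≤ x^q`.
[cite: Lawler2005, §1.10 Prop. 1.21] -/
theorem measureReal_stoppedProcess_eq_le_rpow (hκ0 : 0 < κ) (hκ : κ < 4) (hx₁ : 0 < x₁)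
    (hx₁x : x₁ < x) (hx₂ : x < x₂) (t : ℝ≥0) :
    Process.preWienerMeasure.real
        {ω | stoppedProcess (sleRealFlowStop κ x) (sleExitTime κ x x₁ x₂) t ω = x₁} ≤
      (x₁ / x) ^ (4 / (κ : ℝ) - 1) := by
  haveI := isProbabilityMeasure_preWienerMeasure'
  have hx : 0 < x := hx₁.trans hx₁x
  have hκ0' : (0 : ℝ) < κ := by exact_mod_cast hκ0
  have hκ4 : (κ : ℝ) < 4 := by exact_mod_cast hκ
  set q : ℝ := 1 - 4 / (κ : ℝ) with hqdef
  have hq : q < 0 := by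
    rw [hqdef, sub_neg, lt_div_iff₀ hκ0']; linarith
  have hM := sle_martingale_onePointPow_of_lt_four_holds hκ0 hκ hx₁ hx₁x hx₂
  set M : (ℝ≥0 → ℝ) → ℝ := sleOnePointPow κ x x₁ x₂ t with hMdef
  have hMval : ∀ ω, M ω = stoppedProcess (sleRealFlowStop κ x) (sleExitTime κ x x₁ x₂) t ω ^ q :=
    fun ω ↦ rfl
  have hVpos : ∀ ω, 0 < stoppedProcess (sleRealFlowStop κ x) (sleExitTime κ x x₁ x₂) t ω := fun ω ↦
    hx₁.trans_le (stoppedProcess_sleRealFlowStop_sleExitTime_mem_Icc (κ := κ) hx hx₁x hx₂ t ω).1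
  have hMnonneg : 0 ≤ᵐ[Process.preWienerMeasure] M :=
    ae_of_all _ fun ω ↦ (Real.rpow_pos_of_pos (hVpos ω) q).le
  have hMint : Integrable M Process.preWienerMeasure := hM.integrable t
  -- `E[M_t] = E[M_0] = x^q`
  have hint : ∫ ω, M ω ∂Process.preWienerMeasure = x ^ q := by
    rw [hMdef, integral_eq_of_martingale hM t]
    have h0 : ∀ ω, sleOnePointPow κ x x₁ x₂ 0 ω = x ^ q := fun ω ↦ by
      rw [sleOnePointPow, stoppedProcess_sleRealFlowStop_zero' hx]
    simp_rw [h0]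
    rw [integral_const, smul_eq_mul, probReal_univ, one_mul]
  -- Markov at level `x₁^q`
  have hmarkov := mul_meas_ge_le_integral_of_nonneg hMnonneg hMint (x₁ ^ q)
  rw [hint] at hmarkov
  have hsub : {ω | stoppedProcess (sleRealFlowStop κ x) (sleExitTime κ x x₁ x₂) t ω = x₁} ⊆
      {ω | x₁ ^ q ≤ M ω} := by
    intro ω hω
    rw [mem_setOf_eq, hMval ω, show stoppedProcess (sleRealFlowStop κ x) (sleExitTime κ x x₁ x₂) t ω = x₁
      from hω]
  have hx₁q : 0 < x₁ ^ q := Real.rpow_pos_of_pos hx₁ q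
  calc Process.preWienerMeasure.real
        {ω | stoppedProcess (sleRealFlowStop κ x) (sleExitTime κ x x₁ x₂) t ω = x₁}
      ≤ Process.preWienerMeasure.real {ω | x₁ ^ q ≤ M ω} := measureReal_mono hsub
    _ ≤ x ^ q / x₁ ^ q := by rw [le_div_iff₀ hx₁q, mul_comm]; exact hmarkov
    _ = (x₁ / x) ^ (4 / (κ : ℝ) - 1) := by
        rw [show (4 / (κ : ℝ) - 1) = -q by rw [hqdef]; ring, Real.rpow_neg (div_pos hx₁ hx).le,
          Real.div_rpow hx₁.le hx.le, inv_div]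

/-- **`P{X_{t∧σ} = x₁} ≤ log(x₂/x)/log(x₂/x₁)` for `κ = 4`** (Lawler (2005), proof of Prop. 1.21,
case `a = 1/2`, one-sided and at finite time): `E[log X_{t∧σ}] = log x` (logarithmic martingale) and
`log x₂ - log X_{t∧σ} ≥ 0`, `= log x₂ - log x₁` on `{X_{t∧σ} = x₁}`; Markov's inequality.
[cite: Lawler2005, §1.10 Prop. 1.21] -/
theorem measureReal_stoppedProcess_eq_le_log (hx₁ : 0 < x₁) (hx₁x : x₁ < x) (hx₂ : x < x₂)
    (t : ℝ≥0) :
    Process.preWienerMeasure.real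
        {ω | stoppedProcess (sleRealFlowStop 4 x) (sleExitTime 4 x x₁ x₂) t ω = x₁} ≤
      (Real.log x₂ - Real.log x) / (Real.log x₂ - Real.log x₁) := by
  haveI := isProbabilityMeasure_preWienerMeasure'
  have hx : 0 < x := hx₁.trans hx₁x
  have hM := sle_martingale_onePointLog_holds hx₁ hx₁x hx₂
  set V : (ℝ≥0 → ℝ) → ℝ := fun ω ↦ stoppedProcess (sleRealFlowStop 4 x) (sleExitTime 4 x x₁ x₂) t ω
    with hVdef
  have hVmem : ∀ ω, V ω ∈ Icc x₁ x₂ := fun ω ↦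
    stoppedProcess_sleRealFlowStop_sleExitTime_mem_Icc (κ := 4) hx hx₁x hx₂ t ω
  have hVpos : ∀ ω, 0 < V ω := fun ω ↦ hx₁.trans_le (hVmem ω).1
  set f : (ℝ≥0 → ℝ) → ℝ := fun ω ↦ Real.log x₂ - sleOnePointLog x x₁ x₂ t ω with hfdef
  have hfval : ∀ ω, f ω = Real.log x₂ - Real.log (V ω) := fun ω ↦ rfl
  have hfnonneg : 0 ≤ᵐ[Process.preWienerMeasure] f := ae_of_all _ fun ω ↦ by
    rw [Pi.zero_apply, hfval, sub_nonneg]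
    exact Real.log_le_log (hVpos ω) (hVmem ω).2
  have hfint : Integrable f Process.preWienerMeasure := (integrable_const _).sub (hM.integrable t)
  have hint : ∫ ω, f ω ∂Process.preWienerMeasure = Real.log x₂ - Real.log x := by
    rw [hfdef, integral_sub (integrable_const _) (hM.integrable t), integral_const, smul_eq_mul,
      probReal_univ, one_mul, integral_eq_of_martingale hM t]
    have h0 : ∀ ω, sleOnePointLog x x₁ x₂ 0 ω = Real.log x := fun ω ↦ by
      rw [sleOnePointLog, stoppedProcess_sleRealFlowStop_zero' hx]
    simp_rw [h0]
    rw [integral_const, smul_eq_mul, probReal_univ, one_mul]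
  have hε : 0 < Real.log x₂ - Real.log x₁ := sub_pos.2 (Real.log_lt_log hx₁ (hx₁x.trans hx₂))
  have hmarkov := mul_meas_ge_le_integral_of_nonneg hfnonneg hfint (Real.log x₂ - Real.log x₁)
  rw [hint] at hmarkov
  have hsub : {ω | stoppedProcess (sleRealFlowStop 4 x) (sleExitTime 4 x x₁ x₂) t ω = x₁} ⊆
      {ω | Real.log x₂ - Real.log x₁ ≤ f ω} := by
    intro ω hω
    rw [mem_setOf_eq, hfval ω, show V ω = x₁ from hω]
  calc Process.preWienerMeasure.real
        {ω | stoppedProcess (sleRealFlowStop 4 x) (sleExitTime 4 x x₁ x₂) t ω = x₁}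
      ≤ Process.preWienerMeasure.real {ω | Real.log x₂ - Real.log x₁ ≤ f ω} := measureReal_mono hsub
    _ ≤ (Real.log x₂ - Real.log x) / (Real.log x₂ - Real.log x₁) := by
        rw [le_div_iff₀ hε, mul_comm]; exact hmarkov

/-! ### Step 3: `x₁ → 0+`, then `T_x = ∞` almost surely -/

/-- **The swallowing event sliced by a level is null** (`0 < κ ≤ 4`, `0 < x < x₂`): for every `t`,
`P{T_x ≤ t, level x₂ not reached by time t} = 0`. Indeed this event is contained in
`{X_{t∧σ(x₁,x₂)} = x₁}` for every `x₁ ∈ (0, x)`, whose probability is at most `(x₁/x)^{4/κ-1}`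
(`κ < 4`), resp. `log(x₂/x)/log(x₂/x₁)` (`κ = 4`), and both bounds tend to `0` as `x₁ → 0+`
(Lawler's `lim_{x₁→0+} φ₀(x; x₁, x₂)`). [cite: Lawler2005, §1.10 Prop. 1.21] -/
theorem measure_swallowingTime_le_inter_lt_levelTime_eq_zero (hκ0 : 0 < κ) (hκ : κ ≤ 4)
    (hx : 0 < x) (hx₂ : x < x₂) (t : ℝ≥0) :
    Process.preWienerMeasure {ω | swallowingTime (sleDriving κ ω) x ≤ t ∧
      (t : WithTop ℝ≥0) < levelTime (sleDriving κ ω) x x₂} = 0 := by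
  haveI := isProbabilityMeasure_preWienerMeasure'
  set S : Set (ℝ≥0 → ℝ) := {ω | swallowingTime (sleDriving κ ω) x ≤ t ∧
    (t : WithTop ℝ≥0) < levelTime (sleDriving κ ω) x x₂} with hSdef
  -- the bound as a function of the lower level `x₁`
  set b : ℝ → ℝ := fun x₁ ↦ if κ < 4 then (x₁ / x) ^ (4 / (κ : ℝ) - 1)
    else (Real.log x₂ - Real.log x) / (Real.log x₂ - Real.log x₁) with hbdef
  have hle : ∀ x₁ ∈ Ioo 0 x, Process.preWienerMeasure.real S ≤ b x₁ := by
    intro x₁ hx₁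
    have hsub : S ⊆ {ω | stoppedProcess (sleRealFlowStop κ x) (sleExitTime κ x x₁ x₂) t ω = x₁} :=
      fun ω hω ↦ stoppedProcess_sleRealFlowStop_eq_of_swallowingTime_le hx hx₁.1.le hx₁.2 hω.1 hω.2
    refine (measureReal_mono hsub).trans ?_
    by_cases hκ4 : κ < 4
    · rw [hbdef]; dsimp only; rw [if_pos hκ4]
      exact measureReal_stoppedProcess_eq_le_rpow hκ0 hκ4 hx₁.1 hx₁.2 hx₂ t
    · obtain rfl : κ = 4 := le_antisymm hκ (not_lt.1 hκ4)
      rw [hbdef]; dsimp only; rw [if_neg hκ4]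
      exact measureReal_stoppedProcess_eq_le_log hx₁.1 hx₁.2 hx₂ t
  -- the bound tends to `0` as `x₁ → 0+`
  have htend : Tendsto b (𝓝[>] 0) (𝓝 0) := by
    by_cases hκ4 : κ < 4
    · have hp : 0 < 4 / (κ : ℝ) - 1 := by
        have hκ0' : (0 : ℝ) < κ := by exact_mod_cast hκ0
        have hκ4' : (κ : ℝ) < 4 := by exact_mod_cast hκ4
        rw [sub_pos, lt_div_iff₀ hκ0']; linarith
      have hcont : Continuous fun x₁ : ℝ ↦ (x₁ / x) ^ (4 / (κ : ℝ) - 1) :=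
        (continuous_id.div_const x).rpow_const fun _ ↦ Or.inr hp.le
      have h0 := hcont.tendsto 0
      simp only [zero_div, Real.zero_rpow hp.ne'] at h0
      refine (tendsto_nhdsWithin_of_tendsto_nhds h0).congr fun x₁ ↦ ?_
      rw [hbdef]; dsimp only; rw [if_pos hκ4]
    · have hlog : Tendsto (fun x₁ : ℝ ↦ Real.log x₂ - Real.log x₁) (𝓝[>] 0) atTop := by
        have h := tendsto_neg_atBot_atTop.comp Real.tendsto_log_nhdsGT_zero
        exact (tendsto_atTop_add_const_left _ (Real.log x₂) h).congr fun x₁ ↦ by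
          rw [Function.comp_apply, sub_eq_add_neg]
      have hc : Tendsto (fun _ : ℝ ↦ Real.log x₂ - Real.log x) (𝓝[>] 0)
          (𝓝 (Real.log x₂ - Real.log x)) := tendsto_const_nhds
      refine (hc.div_atTop hlog).congr fun x₁ ↦ ?_
      rw [hbdef]; dsimp only; rw [if_neg hκ4]
  have hev : ∀ᶠ x₁ in 𝓝[>] (0 : ℝ), Process.preWienerMeasure.real S ≤ b x₁ := by
    filter_upwards [Ioo_mem_nhdsGT hx] with x₁ hx₁ using hle x₁ hx₁
  have h0 : Process.preWienerMeasure.real S ≤ 0 := ge_of_tendsto htend hev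
  have h0' : Process.preWienerMeasure.real S = 0 := le_antisymm h0 measureReal_nonneg
  exact (measureReal_eq_zero_iff (measure_ne_top _ _)).1 h0'

/-- **No swallowing for `κ ≤ 4`** (Lawler (2005), Prop. 6.8, first assertion: "if `κ ≤ 4`, then w.p.1 `T_x = ∞` for all `x > 0`" = Prop. 1.21 with `a = 2/κ ≥ 1/2`;
Rohde–Schramm (2005), proof of Lemma 6.2): for `0 < κ ≤ 4` and `x > 0`, almost surely `T_x = ∞`.
From the sliced null events: `{T_x ≤ t} ⊆ ⋃ₙ {T_x ≤ t, level n not reached by time t}` (every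
path is bounded on `[0, t]`, `exists_nat_lt_levelTime`), and `{T_x < ∞} = ⋃ₜ {T_x ≤ t}` over
`t ∈ ℕ`. [cite: Lawler2005, Prop. 6.8] -/
theorem ae_sle_swallowingTime_eq_top_of_le_four :
    ∀ ⦃κ : ℝ≥0⦄, 0 < κ → κ ≤ 4 → ∀ ⦃x : ℝ⦄, 0 < x →
      ∀ᵐ ω ∂Process.preWienerMeasure, swallowingTime (sleDriving κ ω) x = ⊤ := by
  intro κ hκ0 hκ x hx
  -- `P{T_x ≤ t} = 0` for every `t`
  have ht : ∀ t : ℝ≥0, Process.preWienerMeasure {ω | swallowingTime (sleDriving κ ω) x ≤ t} = 0 := by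
    intro t
    have hsub : {ω : ℝ≥0 → ℝ | swallowingTime (sleDriving κ ω) x ≤ t} ⊆
        ⋃ n : ℕ, {ω | swallowingTime (sleDriving κ ω) x ≤ t ∧
          (t : WithTop ℝ≥0) < levelTime (sleDriving κ ω) x ((n : ℝ) + x + 1)} := by
      intro ω hω
      obtain ⟨n, -, hn⟩ := exists_nat_lt_levelTime (continuous_sleDriving κ ω)
        (x := x) (by rwa [sleDriving_zero]) t
      have hmono : levelTime (sleDriving κ ω) x (n : ℝ) ≤
          levelTime (sleDriving κ ω) x ((n : ℝ) + x + 1) := by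
        refine firstHit_mono _ fun z hz ↦ ?_
        simp only [mem_setOf_eq] at hz ⊢
        linarith
      exact mem_iUnion.2 ⟨n, hω, lt_of_lt_of_le hn hmono⟩
    refine measure_mono_null hsub (measure_iUnion_null fun n ↦ ?_)
    exact measure_swallowingTime_le_inter_lt_levelTime_eq_zero hκ0 hκ hx
      (by linarith [n.cast_nonneg (α := ℝ)]) t
  rw [ae_iff]
  have hsub : {ω : ℝ≥0 → ℝ | ¬ swallowingTime (sleDriving κ ω) x = ⊤} ⊆
      ⋃ n : ℕ, {ω | swallowingTime (sleDriving κ ω) x ≤ (n : ℝ≥0)} := by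
    intro ω hω
    obtain ⟨s, hs⟩ := WithTop.ne_top_iff_exists.1 hω
    obtain ⟨n, hn⟩ := exists_nat_ge s
    refine mem_iUnion.2 ⟨n, ?_⟩
    simp only [mem_setOf_eq]
    rw [← hs]
    exact_mod_cast hn
  exact measure_mono_null hsub (measure_iUnion_null fun n ↦ ht n)

/-- **Positive reals are not almost surely swallowed when `κ ≤ 4`** — the hypothesis `h₃` of
`eq_six_of_forall_measureReal_hitsBefore_of_martingale_halfPlane` (`CritPercSLELocalityMartingaleProofs`)
in the exact form used there, now a theorem (Lawler (2005), Prop. 6.8, first assertion).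
[cite: Lawler2005, Prop. 6.8] -/
theorem not_ae_sle_swallowingTime_lt_top_of_le_four :
    ∀ ⦃κ : ℝ≥0⦄ ⦃x : ℝ⦄, 0 < κ → κ ≤ 4 → 0 < x →
      ¬ ∀ᵐ ω ∂Process.preWienerMeasure, swallowingTime (sleDriving κ ω) x < ⊤ := by
  intro κ x hκ0 hκ hx h
  haveI := isProbabilityMeasure_preWienerMeasure'
  have hfalse : ∀ᵐ ω ∂Process.preWienerMeasure, False := by
    filter_upwards [h, ae_sle_swallowingTime_eq_top_of_le_four hκ0 hκ hx] with ω h₁ h₂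
    rw [h₂] at h₁
    exact lt_irrefl _ h₁
  rw [ae_iff] at hfalse
  simp only [not_false_eq_true, setOf_true, measure_univ] at hfalse
  exact one_ne_zero hfalse

/-- **The SLE phases on the real line from the two Itô steps for `κ > 4`**: the named fact
`Literature.Analysis.FunctionSpaces.sle_swallows_real_iff` (`x > 0` is a.s. swallowed iff `κ > 4`;
Rohde–Schramm (2005), Lemma 6.5 and proof of Lemma 6.2; Lawler (2005), Prop. 6.8) follows from
Lawler's one-point martingales for `κ > 4`: "`⇐`" from `sle_martingale_onePointPow`,
`sle_martingale_onePointSq` (`SLEOnePointSwallowingProofs`); "`⇒`" is the theorem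
`not_ae_sle_swallowingTime_lt_top_of_le_four` of this file (by contraposition).
[cite: Lawler2005, Prop. 6.8] -/
theorem sle_swallows_real_iff_of_onePointMartingales (h1 : sle_martingale_onePointPow)
    (h2 : sle_martingale_onePointSq) : Literature.Analysis.FunctionSpaces.sle_swallows_real_iff := by
  intro κ x hκ0 hx
  refine ⟨fun h ↦ ?_, fun hκ ↦ sle_swallowingTime_lt_top_of_onePointMartingales h1 h2 hκ hx⟩
  by_contra hκ
  exact not_ae_sle_swallowingTime_lt_top_of_le_four hκ0 (not_lt.1 hκ) hx h

/-- **The direction "a.s. swallowed `⇒ κ > 4`" of `sle_swallows_real_iff` is a theorem**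
(Rohde–Schramm (2005), proof of Lemma 6.2; Lawler (2005), Prop. 6.8, first assertion): if `κ > 0`,
`x > 0` and `T_x < ∞` almost surely, then `κ > 4`. [cite: Lawler2005, Prop. 6.8] -/
theorem four_lt_of_ae_sle_swallowingTime_lt_top {κ : ℝ≥0} {x : ℝ} (hκ0 : 0 < κ) (hx : 0 < x)
    (h : ∀ᵐ ω ∂Process.preWienerMeasure, swallowingTime (sleDriving κ ω) x < ⊤) : 4 < κ := by
  by_contra hκ
  exact not_ae_sle_swallowingTime_lt_top_of_le_four hκ0 (not_lt.1 hκ) hx h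

end SLE

end Literature.Probability.RandomPlanarGeometry
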